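import Mathlib
import HarnessLib
import Summits.HubbardSuperconductivity.HubbardSuperconductivity.Theorems.KLProgrammeH10TwoPointLimitPerturbedCountCover
import Summits.HubbardSuperconductivity.HubbardSuperconductivity.Theorems.KLProgrammeH10TwoPointLimitPerturbedCountSymmetry
import Summits.HubbardSuperconductivity.HubbardSuperconductivity.Theorems.KLProgrammeH10TwoPointLimitPerturbedFermiRadiusConvexity

/-!
# Route `KLProgramme` — crux K1 `H10TwoPointLimit` (stmt-HubbardSuperconductivity-19938):
# Cooper-range transversality ON THE PERTURBED CURVE (the tree's `odd_transversal`, BGM App. A2 region `R₂`, odd shift)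

Third (S)-lemma of the port HOME/prover-p4/PORT-NOTE.md (architecture (β)), after `cover_perturbed`. The lineage's offset form
`CountPairsOffset.odd_transversal_offset` (generic in the momentum sum `(S_x, S_y)`) says: if `|ε₂(S_x,S_y) - μ| ≤ η₀`, the leg-2
cross term is `≤ λ/2` and `|c - π| ≤ τ`, then the frozen-coefficient shift-line derivative
`2 sin S_x (X'(θ₂) + X'(θ₂ + c)) + 2 sin S_y (Y'(θ₂) + Y'(θ₂ + c))` has modulus `≥ h_min |c - π|`. Here the SAME statement for a root
selection `u` of the perturbed curve `{ε₀ + δ = μ}` (`δ ∈ C²`, even, `|δ| ≤ κ₀`, `‖Dδ‖ ≤ κ₁ < Dt_min`, `‖D(Dδ)‖ ≤ κ₂` on all of `ℝ²`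
— for the `2π`-periodic perturbations of the programme, the bounds on one cell), with the velocities `X_E', Y_E'` of the perturbed
curve and the perturbed leg-2 partial (including its `Dδ` term), at the price of an explicit `O(κ₀ + κ₁ + κ₂ + η₀ + λ + τ)` loss
absorbed by the smallness hypothesis (`odd_transversal_perturbed`, conclusion `h_min |c - π| ≤ |…|` under `ERR ≤ h_min/2`).
Proof = the tree's, step for step, with every free fact replaced by its landed perturbed counterpart: leg-2 alignment
`exists_int_near_of_h3E_small` (…PerturbedCountCover), central symmetry `X_E'(θ + π) = -X_E'(θ)` (`curve_add_pi`, …Symmetry), the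
frozen-coefficient mean value theorem with `(d/dθ) X_E' = X_E''` (`hasDerivAt_VXE`, …SecondOrder), sign alignment `exists_sign_align`
at the shifted level of the intermediate point, and the fold quantity `|sin X_E X_E'' + sin Y_E Y_E''| ≥ h_min - O(κ₁ + κ₂)`
(`abs_sin_mul_accel_ge`, …Convexity). Everything is PROVED; no definitions.
References: BGM 2006 App. A2 [cite: BenfattoGiulianiMastropietro2006]; HOME/prover-p4/COUNTING-NOTE.md (the offset scheme).
-/

noncomputable section

namespace Summit.HubbardSuperconductivity.HubbardSuperconductivity.Theorems.PerturbedFermiCurve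

set_option linter.dupNamespace false -- summit = problem name (single-conjunct summit), D-0017

open Real Set
open Literature.MathematicalPhysics.QuantumLattice Literature.MathematicalPhysics.QuantumLattice.BandSectorCounting

section Cooper

variable {a b : ℝ} (B : BandBounds a b) {δ : (Fin 2 → ℝ) → ℝ} (hδs : ContDiff ℝ 2 δ) (heven : ∀ k, δ (-k) = δ k)
  {κ₀ κ₁ κ₂ μ : ℝ} (hδ : ∀ k : Fin 2 → ℝ, |δ k| ≤ κ₀) (hlo : a ≤ μ - κ₀) (hhi : μ + κ₀ ≤ b)
  (hκ : ∀ k : Fin 2 → ℝ, ‖fderiv ℝ δ k‖ ≤ κ₁) (hκ₁ : κ₁ < B.Dtmin) (hκ₂ : ∀ k : Fin 2 → ℝ, ‖fderiv ℝ (fderiv ℝ δ) k‖ ≤ κ₂)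
  {u : ℝ → ℝ} (hu : ∀ θ, IsBandFermiRadius (μ - δ (u θ • dir θ)) θ (u θ))
include B hδs heven hδ hlo hhi hκ hκ₁ hκ₂ hu

/-- **Cooper-range transversality on the perturbed curve** (the tree's `odd_transversal` / the lineage's `odd_transversal_offset`
for the moving curve). Constants: `C_V = (π√2 + 2s_max)/(Dt_min - κ₁)`, `S_E = s_max + κ₁C_V`, `U₁ = (4+κ₁)π√2/(Dt_min - κ₁)`,
`U₂` = `abs_second_deriv_le`'s bound, `A_E = U₂ + 2U₁ + π√2`, `ε₄` = `exists_int_near_of_h3E_small`'s tolerance with `e = η₀/Dt_min`,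
`e_tot = η₀/Dt_min + 2κ₀/Dt_min + s_max (C_g ε₄ + τ)`; smallness `ERR = 4κ₁C_V(S_E + s_max) + (κ₂S_E² + κ₁A_E)/2 + 2A_E e_tot ≤ h_min/2`.
[cite: BenfattoGiulianiMastropietro2006, App. A2] -/
theorem odd_transversal_perturbed {Sx Sy μ' θ₂ c τ η₀ lam : ℝ} (hμ' : μ' ∈ Icc a b) (hlo' : a ≤ μ' - η₀) (hhi' : μ' + η₀ ≤ b)
    (hh' : |eps2 Sx Sy - μ'| ≤ η₀) (hgap : ∀ θ, |μ' - (μ - δ (u θ • dir θ))| ≤ 2 * κ₀) {S : Fin 2 → ℝ}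
    (hd2 : |2 * Real.sin Sx * VXE u θ₂ + 2 * Real.sin Sy * VYE u θ₂ + fderiv ℝ δ S ![VXE u θ₂, VYE u θ₂]| ≤ lam)
    (hc : |c - π| ≤ τ)
    (hsmall :
      4 * (κ₁ * (π * Real.sqrt 2 + 2 * B.smax) / (B.Dtmin - κ₁)) *
            ((B.smax + κ₁ * (π * Real.sqrt 2 + 2 * B.smax) / (B.Dtmin - κ₁)) + B.smax) +
          (κ₂ * (B.smax + κ₁ * (π * Real.sqrt 2 + 2 * B.smax) / (B.Dtmin - κ₁)) ^ 2 +
              κ₁ * (((4 + κ₂) * (B.smax + κ₁ * (π * Real.sqrt 2 + 2 * B.smax) / (B.Dtmin - κ₁)) ^ 2 +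
                    (8 + 2 * κ₁) * ((4 + κ₁) * (π * Real.sqrt 2) / (B.Dtmin - κ₁)) + (4 + κ₁) * (π * Real.sqrt 2)) /
                    (B.Dtmin - κ₁) +
                  2 * ((4 + κ₁) * (π * Real.sqrt 2) / (B.Dtmin - κ₁)) + π * Real.sqrt 2)) / 2 +
        2 * (((4 + κ₂) * (B.smax + κ₁ * (π * Real.sqrt 2 + 2 * B.smax) / (B.Dtmin - κ₁)) ^ 2 +
                (8 + 2 * κ₁) * ((4 + κ₁) * (π * Real.sqrt 2) / (B.Dtmin - κ₁)) + (4 + κ₁) * (π * Real.sqrt 2)) /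
                (B.Dtmin - κ₁) +
              2 * ((4 + κ₁) * (π * Real.sqrt 2) / (B.Dtmin - κ₁)) + π * Real.sqrt 2) *
          (η₀ / B.Dtmin + 2 * κ₀ / B.Dtmin +
            B.smax * (B.Cg * (lam / 2 +
              κ₁ * (B.smax + κ₁ * (π * Real.sqrt 2 + 2 * B.smax) / (B.Dtmin - κ₁)) / 2 +
              2 * (κ₁ * (π * Real.sqrt 2 + 2 * B.smax) / (B.Dtmin - κ₁)) + 2 * B.smax * (η₀ / B.Dtmin) +
              2 * B.smax * (2 * κ₀ / B.Dtmin)) + τ)) ≤ B.hmin / 2) :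
    B.hmin * |c - π| ≤ |2 * Real.sin Sx * (VXE u θ₂ + VXE u (θ₂ + c)) + 2 * Real.sin Sy * (VYE u θ₂ + VYE u (θ₂ + c))| := by
  have h2ne : (2 : WithTop ℕ∞) ≠ 0 := by norm_num
  have hδ' : ∀ k : Fin 2 → ℝ, (∀ i, |k i| ≤ π) → |δ k| ≤ κ₀ := fun k _ => hδ k
  have hκ' : ∀ k : Fin 2 → ℝ, (∀ i, |k i| ≤ π) → ‖fderiv ℝ δ k‖ ≤ κ₁ := fun k _ => hκ k
  have hκ₂' : ∀ k : Fin 2 → ℝ, (∀ i, |k i| ≤ π) → ‖fderiv ℝ (fderiv ℝ δ) k‖ ≤ κ₂ := fun k _ => hκ₂ k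
  have hd' : ∀ k : Fin 2 → ℝ, (∀ i, |k i| ≤ π) → DifferentiableAt ℝ δ k := fun k _ => (hδs.differentiable h2ne) k
  -- constants
  set CV := κ₁ * (π * Real.sqrt 2 + 2 * B.smax) / (B.Dtmin - κ₁) with hCV
  set SE := B.smax + κ₁ * (π * Real.sqrt 2 + 2 * B.smax) / (B.Dtmin - κ₁) with hSE
  set U1 := (4 + κ₁) * (π * Real.sqrt 2) / (B.Dtmin - κ₁) with hU1
  set U2 := ((4 + κ₂) * SE ^ 2 + (8 + 2 * κ₁) * U1 + (4 + κ₁) * (π * Real.sqrt 2)) / (B.Dtmin - κ₁) with hU2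
  set AE := U2 + 2 * U1 + π * Real.sqrt 2 with hAE
  set ε4 := lam / 2 + κ₁ * SE / 2 + 2 * CV + 2 * B.smax * (η₀ / B.Dtmin) + 2 * B.smax * (2 * κ₀ / B.Dtmin) with hε4
  set etot := η₀ / B.Dtmin + 2 * κ₀ / B.Dtmin + B.smax * (B.Cg * ε4 + τ) with hetot
  have hs := B.smax_pos; have hDt := B.Dtmin_pos; have hCg := B.Cg_pos
  have hden : 0 < B.Dtmin - κ₁ := sub_pos.2 hκ₁
  have hκ₁0 : 0 ≤ κ₁ := (norm_nonneg _).trans (hκ S)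
  have hτ : 0 ≤ τ := (abs_nonneg _).trans hc
  set t := c - π with ht
  have hct : c = π + t := by rw [ht]; ring
  -- Step 1: localisation of the momentum sum and alignment of leg 2
  obtain ⟨φ, hsx, hsy, -, -⟩ := exists_near_curve_trig B hμ' hh' hlo' hhi'
  obtain ⟨j, hj⟩ := exists_int_near_of_h3E_small B hδs h2ne hδ hlo hhi hκ hκ₁ hu hμ' hsx hsy θ₂ (hgap θ₂) hd2
  -- Step 2: the frozen-coefficient mean value theorem
  have hu2 : ContDiff ℝ 2 u := contDiff_of_isRoot B hδs h2ne hδ' hlo hhi hκ' hκ₁ hu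
  have hud : ∀ x, DifferentiableAt ℝ u x := fun x => (hu2.differentiable h2ne) x
  have hud' : ∀ x, DifferentiableAt ℝ (deriv u) x := by
    have h2 : ContDiff ℝ ((1 : WithTop ℕ∞) + 1) u := by rw [one_add_one_eq_two]; exact hu2
    have h : ContDiff ℝ 1 (deriv u) := (contDiff_succ_iff_deriv.1 h2).2.2
    exact fun x => (h.differentiable one_ne_zero) x
  have hfd : ∀ x, HasDerivAt (fun x => 2 * Real.sin Sx * VXE u x + 2 * Real.sin Sy * VYE u x)
      (2 * Real.sin Sx * (deriv (deriv u) x * Real.cos x - 2 * deriv u x * Real.sin x - u x * Real.cos x) +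
        2 * Real.sin Sy * (deriv (deriv u) x * Real.sin x + 2 * deriv u x * Real.cos x - u x * Real.sin x)) x := fun x =>
    ((hasDerivAt_VXE (hud x) (hud' x)).const_mul (2 * Real.sin Sx)).add
      ((hasDerivAt_VYE (hud x) (hud' x)).const_mul (2 * Real.sin Sy))
  obtain ⟨ξ, hξ, hslope⟩ := exists_slope hfd θ₂ t
  obtain ⟨-, -, qvx, qvy⟩ := curve_add_pi B hδ' hlo hhi hd' hκ' hκ₁ hu heven (θ₂ + t)
  have hθc : θ₂ + c = θ₂ + t + π := by rw [hct]; ring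
  set AX := deriv (deriv u) ξ * Real.cos ξ - 2 * deriv u ξ * Real.sin ξ - u ξ * Real.cos ξ with hAX
  set AY := deriv (deriv u) ξ * Real.sin ξ + 2 * deriv u ξ * Real.cos ξ - u ξ * Real.sin ξ with hAY
  have hD : 2 * Real.sin Sx * (VXE u θ₂ + VXE u (θ₂ + c)) + 2 * Real.sin Sy * (VYE u θ₂ + VYE u (θ₂ + c)) =
      -(t * (2 * Real.sin Sx * AX + 2 * Real.sin Sy * AY)) := by
    rw [hθc, qvx, qvy]
    linarith [hslope]
  -- Step 3: alignment of `ξ` with `φ`, and the sines of the sum against the perturbed point at `ξ`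
  have hξt : |ξ - θ₂| ≤ |t| := abs_le_of_mem_between hξ
  set ε2 := B.Cg * ε4 + τ with hε2
  have halign : |φ - ξ - j * π| ≤ ε2 := by
    calc |φ - ξ - j * π| = |(φ - θ₂ - j * π) - (ξ - θ₂)| := by ring_nf
      _ ≤ |φ - θ₂ - j * π| + |ξ - θ₂| := abs_sub _ _
      _ ≤ B.Cg * ε4 + τ := add_le_add hj (hξt.trans hc)
  set νξ := μ - δ (u ξ • dir ξ) with hνξ
  have hνξmem : νξ ∈ Icc a b := shiftedLevel_mem_Icc (hu ξ) hδ' hlo hhi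
  obtain ⟨σ, hσ, ax, ay, -, -⟩ := exists_sign_align B hνξmem halign
  have hσabs : |σ| = 1 := by rcases hσ with rfl | rfl <;> norm_num
  obtain ⟨hXξ, hYξ⟩ := XE_eq_bandX_shifted B hδ' hlo hhi hu ξ
  have hradφ : |bandFermiRadius μ' φ - bandFermiRadius νξ φ| ≤ 2 * κ₀ / B.Dtmin :=
    (abs_bandFermiRadius_sub_le_of_level B hνξmem hμ' φ).trans (div_le_div_of_nonneg_right (hgap ξ) hDt.le)
  have s2x : |Real.sin (bandX μ' φ) - Real.sin (bandX νξ φ)| ≤ 2 * κ₀ / B.Dtmin := by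
    refine (Real.abs_sin_sub_sin_le _ _).trans ?_
    rw [bandX, bandX, ← sub_mul, abs_mul]
    exact (mul_le_of_le_one_right (abs_nonneg _) (Real.abs_cos_le_one φ)).trans hradφ
  have s2y : |Real.sin (bandY μ' φ) - Real.sin (bandY νξ φ)| ≤ 2 * κ₀ / B.Dtmin := by
    refine (Real.abs_sin_sub_sin_le _ _).trans ?_
    rw [bandY, bandY, ← sub_mul, abs_mul]
    exact (mul_le_of_le_one_right (abs_nonneg _) (Real.abs_sin_le_one φ)).trans hradφ
  have cx : |σ * Real.sin Sx - Real.sin (XE u ξ)| ≤ etot := by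
    rw [hXξ]
    have e : σ * Real.sin Sx - Real.sin (bandX νξ ξ) =
        σ * ((Real.sin Sx - Real.sin (bandX μ' φ)) + (Real.sin (bandX μ' φ) - Real.sin (bandX νξ φ))) +
          (σ * Real.sin (bandX νξ φ) - Real.sin (bandX νξ ξ)) := by ring
    rw [e]
    refine (abs_add_le _ _).trans ?_
    rw [abs_mul, hσabs, one_mul]
    have := abs_add_le (Real.sin Sx - Real.sin (bandX μ' φ)) (Real.sin (bandX μ' φ) - Real.sin (bandX νξ φ))
    rw [hetot]; linarith
  have cy : |σ * Real.sin Sy - Real.sin (YE u ξ)| ≤ etot := by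
    rw [hYξ]
    have e : σ * Real.sin Sy - Real.sin (bandY νξ ξ) =
        σ * ((Real.sin Sy - Real.sin (bandY μ' φ)) + (Real.sin (bandY μ' φ) - Real.sin (bandY νξ φ))) +
          (σ * Real.sin (bandY νξ φ) - Real.sin (bandY νξ ξ)) := by ring
    rw [e]
    refine (abs_add_le _ _).trans ?_
    rw [abs_mul, hσabs, one_mul]
    have := abs_add_le (Real.sin Sy - Real.sin (bandY μ' φ)) (Real.sin (bandY μ' φ) - Real.sin (bandY νξ φ))
    rw [hetot]; linarith
  -- Step 4: the accelerations at `ξ` and the perturbed fold quantity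
  have hsq := abs_apply_le_pi_of_isBandFermiRadius (hu ξ)
  have hupos : 0 < u ξ := (mem_Ioo_of_shifted B hδ' hlo hhi (hu ξ)).1
  have hule : u ξ ≤ π * Real.sqrt 2 := root_le_pi_mul_sqrt_two B hδ' hlo hhi hu ξ
  have hu1 : |deriv u ξ| ≤ U1 := by
    refine (abs_deriv_le B hδs h2ne hδ' hlo hhi hκ' hκ₁ hu ξ).trans ?_
    rw [hU1]; exact div_le_div_of_nonneg_right (mul_le_mul_of_nonneg_left hule (by linarith)) hden.le
  have hu2b : |deriv (deriv u) ξ| ≤ U2 := abs_second_deriv_le B hδs hδ' hlo hhi hκ' hκ₁ hκ₂' hu ξ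
  have hU10 : 0 ≤ U1 := (abs_nonneg _).trans hu1
  have hsθ := Real.abs_sin_le_one ξ; have hcθ := Real.abs_cos_le_one ξ
  have hAXb : |AX| ≤ AE := by
    have e1 : |deriv (deriv u) ξ * Real.cos ξ| ≤ U2 := by
      rw [abs_mul]; exact (mul_le_of_le_one_right (abs_nonneg _) hcθ).trans hu2b
    have e2 : |2 * deriv u ξ * Real.sin ξ| ≤ 2 * U1 := by
      rw [abs_mul, abs_mul, abs_two]
      have := mul_le_mul hu1 hsθ (abs_nonneg _) hU10
      linarith
    have e3 : |u ξ * Real.cos ξ| ≤ π * Real.sqrt 2 := by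
      rw [abs_mul, abs_of_pos hupos]; exact (mul_le_of_le_one_right hupos.le hcθ).trans hule
    have := abs_sub (deriv (deriv u) ξ * Real.cos ξ - 2 * deriv u ξ * Real.sin ξ) (u ξ * Real.cos ξ)
    have := abs_sub (deriv (deriv u) ξ * Real.cos ξ) (2 * deriv u ξ * Real.sin ξ)
    rw [hAE]; linarith
  have hAYb : |AY| ≤ AE := by
    have e1 : |deriv (deriv u) ξ * Real.sin ξ| ≤ U2 := by
      rw [abs_mul]; exact (mul_le_of_le_one_right (abs_nonneg _) hsθ).trans hu2b
    have e2 : |2 * deriv u ξ * Real.cos ξ| ≤ 2 * U1 := by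
      rw [abs_mul, abs_mul, abs_two]
      have := mul_le_mul hu1 hcθ (abs_nonneg _) hU10
      linarith
    have e3 : |u ξ * Real.sin ξ| ≤ π * Real.sqrt 2 := by
      rw [abs_mul, abs_of_pos hupos]; exact (mul_le_of_le_one_right hupos.le hsθ).trans hule
    have := abs_sub (deriv (deriv u) ξ * Real.sin ξ + 2 * deriv u ξ * Real.cos ξ) (u ξ * Real.sin ξ)
    have := abs_add_le (deriv (deriv u) ξ * Real.sin ξ) (2 * deriv u ξ * Real.cos ξ)
    rw [hAE]; linarith
  have hcoreE := abs_sin_mul_accel_ge B hδs hδ' hlo hhi hκ' hκ₁ hκ₂' hu ξ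
  -- from the perturbed point's sines to `σ sin S`
  have hR := abs_two_term_sub_le (σ * Real.sin Sx) (σ * Real.sin Sy) (Real.sin (XE u ξ)) (Real.sin (YE u ξ)) AX AY
  have hetot0 : 0 ≤ etot := (abs_nonneg _).trans cx
  have bR1 : |σ * Real.sin Sx - Real.sin (XE u ξ)| * |AX| ≤ etot * AE := mul_le_mul cx hAXb (abs_nonneg _) hetot0
  have bR2 : |σ * Real.sin Sy - Real.sin (YE u ξ)| * |AY| ≤ etot * AE := mul_le_mul cy hAYb (abs_nonneg _) hetot0
  have hcore : B.hmin / 2 ≤ |Real.sin Sx * AX + Real.sin Sy * AY| := by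
    have e1 : |σ * Real.sin Sx * AX + σ * Real.sin Sy * AY| = |Real.sin Sx * AX + Real.sin Sy * AY| := by
      rw [show σ * Real.sin Sx * AX + σ * Real.sin Sy * AY = σ * (Real.sin Sx * AX + Real.sin Sy * AY) by ring, abs_mul, hσabs,
        one_mul]
    have e2 := abs_sub_abs_le_abs_sub (Real.sin (XE u ξ) * AX + Real.sin (YE u ξ) * AY) (σ * Real.sin Sx * AX + σ * Real.sin Sy * AY)
    rw [abs_sub_comm] at e2
    rw [← e1]
    -- the smallness hypothesis, in the abbreviated constants
    have hsm : 4 * CV * (SE + B.smax) + (κ₂ * SE ^ 2 + κ₁ * AE) / 2 + 2 * AE * etot ≤ B.hmin / 2 := hsmall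
    have hc' : B.hmin - 4 * CV * (SE + B.smax) - (κ₂ * SE ^ 2 + κ₁ * AE) / 2 ≤ |Real.sin (XE u ξ) * AX + Real.sin (YE u ξ) * AY| :=
      hcoreE
    linarith
  have hfin : 2 * Real.sin Sx * AX + 2 * Real.sin Sy * AY = 2 * (Real.sin Sx * AX + Real.sin Sy * AY) := by ring
  rw [hD, abs_neg, abs_mul, hfin, abs_mul, abs_two]
  have := mul_le_mul_of_nonneg_left hcore (abs_nonneg t)
  linarith

end Cooper

end Summit.HubbardSuperconductivity.HubbardSuperconductivity.Theorems.PerturbedFermiCurve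

end
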